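import Summits.QuantumFields.YangMills.Theorems.BalabanUVNodesN12FlatChartHnd
import Summits.QuantumFields.YangMills.Theorems.UnitScaleTiltProp7AxialGauge
import HarnessLib

/-!
# BalabanUVNodes ∕ N12 — (β)♭ IN PRINT's GAUGE: THE LINEARISED `k`-FOLD COMB-AXIAL SLICE IS TRANSVERSAL TO `Lie (4)`, HENCE THE NONDEGENERACY ∕ POSITIVITY LETTER AT NODE 00's FLAT
# MULTI-SCALE CHART HOLDS IN THAT GAUGE WITH NO SLICE LETTER LEFT — [Balaban1985Variational] (4) p. 278, (18) p. 280 «we fix the axial gauge conditions Ax_k(𝔅_k, U₀)», Sect. E p. 300;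
# [Balaban1985RegularSpaces] p. 79 «The conditions (1.19) determine uniquely an element in each orbit given by the subgroup (1.14)»; [Balaban1989LargeFieldII] (1.9) p. 358, p. 359

Cell `pub-ymgap` (HUMAN RULINGS D-0062 ∕ D-0149), WIDTH SEAT `pub-ymgap-dag-n12-w3` g2 (node N12 = [B15]; key K1⁷ `stmt-QuantumFields-20542`, `--kind proof --supports … --as helper`;
count-neutral).  THEOREMS ONLY (0 `def`, 0 `instance`, 0 `sorry`); every input CONSUMED BY NAME, nothing modified: this seat's `N12FlatFibreNullSpace.eq_zero_of_transversal_of_iterLin_eq_zero`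
and `N12FlatChartHnd.eq_zero_of_fderiv_msChart_one_eq_zero_of_transversal` ∕ `hnd_flat_msChart_prod` ∕ `deriv_deriv_wilsonAction4_expChart_one_nonneg`; the route UnitScaleTilt's comb axial
gauge `Prop7AxialGauge.eq_one_of_axialGauge` ∕ `axialT_gaugeActT` over the torus transport `B10Eq27TorusAxialLog.axialT` ∕ `gaugeActT` ∕ `holT_one`.

THE DEVICE.  The LINEARISED comb-axial gauge condition on a Lie-algebra (or any additive-group) valued bond field `X` — «the signed sum of `X` along the comb `Γ_{y(x),x}` from the centre
`y(x) = embIter k (iterBlockOf k x)` of the `k`-block of `x` to `x` vanishes for every fine site `x`» — IS the nonlinear comb-axial gauge condition of `Prop7AxialGauge` for the COMMUTATIVE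
gauge group `Multiplicative V`: the comb holonomy `axialT (b ↦ ofAdd (X b)) y(x) x` is `ofAdd` of that signed sum, and an infinitesimal gauge transformation `X ↦ X − dψ` is the gauge action
of `ofAdd ∘ ψ`.  So the tree's UNIQUENESS of the (4)-element in the complete comb axial gauge, read in `Multiplicative V`, says: a pure gauge `dφ` with `φ = 0` at the `k`-fold centres which is
comb-axial is `0` — the transversality letter `hS` of the two previous files.

CONTENTS.
§1 ★★ `grad_eq_zero_of_combAxial` — transversality of the linearised comb-axial slice to the centre-vanishing pure gauges (any additive commutative group of values).
§2 ★★ `eq_zero_of_combAxial_of_iterLin_eq_zero` — torus form: a comb-axial matrix field with vanishing plaquette variables and vanishing `k`-fold linearised average is `0`.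
§3 at NODE 00's objects, for `𝔹` constraining every level-`k` bond: ★★★ `eq_zero_of_fderiv_msChart_one_eq_zero_of_combAxial` (comb-axial `X` with `DΦ(0)X = 0` and `d²∕ds²A(e^{sX})|₀ = 0` is `0`),
   ★★ `deriv_deriv_pos_of_fderiv_msChart_one_eq_zero_of_combAxial` (POSITIVITY: `X ≠ 0` comb-axial in `ker DΦ(0)` ⟹ `0 < d²∕ds²A(e^{sX})|₀` — the real input of dag-n12-w1∕w2's complexification
   junctions `real_nondegenerate_of_pos` ∕ `hnondeg_of_deriv_deriv_re_pos` at the flat base field), ★★ `hnd_flat_msChart_prod_of_combAxial` (the `hnd` binder of the U2b theorem for every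
   gauge-fixed flat chart `(Φ, G)` whose gauge condition implies the comb-axial one).

HONEST FRAMING.  Flat configuration only (`U₀ = 1`); complete COMB axial gauge from the `k`-fold centres (the route UnitScaleTilt's reading of [15] (18); print's `Ax_k(𝔅_k, U₀)` of
[Balaban1985RegularSpaces] (1.19) is the iterated level-by-level variant — both are complete gauges of the group (4)); `𝔹 ⊇` all level-`k` bonds; the `honto` letter and the near-flat
backgrounds are NOT treated; no coercivity constant.  Nothing of Bałaban's estimates is asserted; N12 NOT discharged; K1⁷ NOT closed; counts unmoved (typed 28∕28 · discharged 5∕27); one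
finite 𝕋⁴ programme at fixed ε — R4 closes the conditional rung `BalabanLadder.UV` only; the Yang–Mills mass gap (Clay) is NOT proved by any of this; nothing continuum ∕ ℝ⁴ ∕ OS.
-/

noncomputable section

namespace Summit.QuantumFields.YangMills.BalabanUVNodes.N12FlatCombAxialHnd

open scoped BigOperators Matrix.Norms.L2Operator Topology
open Literature.MathematicalPhysics.QuantumFieldTheory.Balaban1983to89
open T4Continuum (T4Family)
open BlockAveragingEMLLinearised (linAvg)
open T4AdjointCovarianceUnitary (lieSU)
open B15DeterminingSets
open B5Eq118OneStroke (iterBlockOf)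
open B10Eq27TorusAxialLog (axialT gaugeActT)
open Node00
open Summit.QuantumFields.YangMills.Theorems.Prop7AxialGauge (eq_one_of_axialGauge axialT_gaugeActT)
open Summit.QuantumFields.YangMills.BalabanUVNodes.N12FlatFibreNullSpace (eq_zero_of_transversal_of_iterLin_eq_zero)
open Summit.QuantumFields.YangMills.BalabanUVNodes.N12FlatChartHnd (eq_zero_of_fderiv_msChart_one_eq_zero_of_transversal hnd_flat_msChart_prod)

/-! ## §1 The linearised comb-axial slice is transversal to the centre-vanishing pure gauges -/

section Transversal

variable {P : Params} {k : ℕ} {V : Type*} [AddCommGroup V]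

/-- **THE LINEARISED `k`-FOLD COMB-AXIAL GAUGE IS TRANSVERSAL TO `Lie (4)`**: if `φ` vanishes at every `k`-fold centre and its gradient `dφ` is comb-axial — the signed sum of
`dφ` along the comb `Γ_{y(x),x}` from the centre `y(x)` of the `k`-block of `x` to `x` vanishes for every fine site `x`, written as the comb holonomy `axialT` of the
`Multiplicative V`-valued field `b ↦ dφ(b)` being `1` — then `dφ = 0`.  This is the route UnitScaleTilt's UNIQUENESS of the (4)-element in the complete comb axial gauge
(`Prop7AxialGauge.eq_one_of_axialGauge`, [Balaban1985RegularSpaces] p. 79) applied to the commutative gauge group `Multiplicative V`: `dφ` is the gauge transform of the trivial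
configuration by `ofAdd ∘ (−φ)`. [cite: Balaban1985RegularSpaces, p.79 (sentence after (1.20)); Balaban1985Variational, (4) p.278, (18) p.280] -/
theorem grad_eq_zero_of_combAxial (φ : Site P 0 → V) (hφ : ∀ y : Site P k, φ (embIter k y) = 0)
    (hax : ∀ x : Site P 0, axialT (fun b : PBond P 0 => Multiplicative.ofAdd (φ b.tgt - φ b.src)) (embIter k (iterBlockOf k x)) x = 1) :
    ∀ b : PBond P 0, φ b.tgt - φ b.src = 0 := by
  -- `dφ = 1^{w}` with `w = ofAdd ∘ (−φ)` in the group (4)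
  set w : GaugeTransf P 0 (Multiplicative V) := fun x => Multiplicative.ofAdd (-φ x) with hw
  have hgauge : gaugeActT w (fun _ : PBond P 0 => (1 : Multiplicative V)) = fun b : PBond P 0 => Multiplicative.ofAdd (φ b.tgt - φ b.src) := by
    funext b
    rw [B10Eq27TorusAxialLog.gaugeActT_apply, mul_one, hw, ← ofAdd_neg, ← ofAdd_add, neg_neg]
    congr 1
    abel
  have hw1 : ∀ y : Site P k, w (embIter k y) = 1 := fun y => by
    rw [hw]
    show Multiplicative.ofAdd (-φ (embIter k y)) = 1
    rw [hφ y, neg_zero, ofAdd_zero]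
  have htriv : ∀ x : Site P 0, axialT (fun _ : PBond P 0 => (1 : Multiplicative V)) (embIter k (iterBlockOf k x)) x = 1 := fun x =>
    B10Eq27TorusAxialLog.holT_one _ _
  have h1 := eq_one_of_axialGauge (k := k) (fun _ : PBond P 0 => (1 : Multiplicative V)) (fun _ : PBond P 0 => (1 : Multiplicative V)) w hw1
    (fun _ => rfl) (fun x => by rw [hgauge, hax x, htriv x])
  intro b
  have hs := congrFun h1 b.src
  have ht := congrFun h1 b.tgt
  simp only [hw, ofAdd_eq_one, neg_eq_zero] at hs ht
  rw [hs, ht, sub_zero]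

end Transversal

/-! ## §2 On the torus: a comb-axial, curl-free matrix field on the linearised fibre vanishes -/

section Torus

variable {P : Params} {n : Type*} [Fintype n] [DecidableEq n]

omit [Fintype n] [DecidableEq n] in
/-- ★★ **`hnd` AT THE FLAT CONFIGURATION IN PRINT's GAUGE, torus form**: a fine matrix-valued bond field in the linearised `k`-fold COMB-AXIAL gauge (signed sums along the combs from the
`k`-fold centres vanish), all of whose plaquette variables vanish and whose `k`-fold linearised (0.4) average vanishes on every level-`k` bond, is `0` — the null-space theorem
`N12FlatFibreNullSpace.eq_zero_of_transversal_of_iterLin_eq_zero` with the slice letter DISCHARGED by §1. [cite: Balaban1985Variational, (4) p.278, (18) p.280, Sect. E p.300; Balaban1989LargeFieldII, (1.9) p.358, p.359] -/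
theorem eq_zero_of_combAxial_of_iterLin_eq_zero
    (Q : (i : ℕ) → (PBond P 0 → Matrix n n ℂ) → PBond P i → Matrix n n ℂ)
    (hQ0 : ∀ Y, Q 0 Y = Y) (hQs : ∀ (i : ℕ) (Y : PBond P 0 → Matrix n n ℂ) (c : PBond P (i + 1)), Q (i + 1) Y c = linAvg (Q i Y) c)
    (k : ℕ) {X : PBond P 0 → Matrix n n ℂ}
    (hax : ∀ x : Site P 0, axialT (fun b : PBond P 0 => Multiplicative.ofAdd (X b)) (embIter k (iterBlockOf k x)) x = 1)
    (hcurl : ∀ p : Plaq P 0, X ⟨p.src, p.μ⟩ + X ⟨p.src.shift p.μ, p.ν⟩ - X ⟨p.src.shift p.ν, p.μ⟩ - X ⟨p.src, p.ν⟩ = 0)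
    (hQ : ∀ c : PBond P k, Q k X c = 0) : X = 0 := by
  have hS : ∀ φ : Site P 0 → Matrix n n ℂ, (∀ y : Site P k, φ (embIter k y) = 0) →
      (fun b : PBond P 0 => φ b.tgt - φ b.src) ∈
        {Y : PBond P 0 → Matrix n n ℂ | ∀ x : Site P 0, axialT (fun b : PBond P 0 => Multiplicative.ofAdd (Y b)) (embIter k (iterBlockOf k x)) x = 1} →
      ∀ b : PBond P 0, φ b.tgt - φ b.src = 0 := fun φ hφ hmem =>
    grad_eq_zero_of_combAxial φ hφ hmem
  exact eq_zero_of_transversal_of_iterLin_eq_zero Q hQ0 hQs k hS hax hcurl hQ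

end Torus

/-! ## §3 At NODE 00's objects: the nondegeneracy letter at the flat base field in the comb-axial gauge, hypothesis-free -/

section NodeZero

variable {F : T4Family} {N : ℕ} [NeZero N] {K k : ℕ}

/-- ★★★ **`hnd` AT THE FLAT CONFIGURATION OF NODE 00 IN THE COMB-AXIAL GAUGE — NO SLICE LETTER LEFT.**  Let `𝔹` constrain every level-`k` bond.  A fine `𝔰𝔲(N)`-field `X` in the
linearised `k`-fold comb-axial gauge which lies in the kernel of the derivative at `0` of the flat multi-scale chart `Φ = msChart F N K k 𝔹 (M˙1) 1` and along which the flat second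
variation `d²∕ds² A(e^{sX})|₀` vanishes is `X = 0` ([LF-II] p. 359 «P₀H*Δ₁HP₀ is positive, hence invertible on this subspace», the injectivity half, at `U₀ = 1`).
[cite: Balaban1989LargeFieldII, (1.9) p.358, p.359; Balaban1985Variational, (4) p.278, (18) p.280, (83) p.290, Sect. E p.300] -/
theorem eq_zero_of_fderiv_msChart_one_eq_zero_of_combAxial (𝔹 : DetSet (F.P K)) (h𝔹 : ∀ c : PBond (F.P K) k, c ∈ bondsOf (𝔹 k))
    {X : PBond (F.P K) 0 → lieSU (Fin N)}
    (hax : ∀ x : Site (F.P K) 0, axialT (fun b : PBond (F.P K) 0 => Multiplicative.ofAdd (X b)) (embIter k (iterBlockOf k x)) x = 1)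
    (hker : fderiv ℝ (msChart F N K k 𝔹 (avgFamily (avOfRecord F N K) (1 : GaugeField (F.P K) 0 (SU N))) (1 : GaugeField (F.P K) 0 (SU N))) 0 X = 0)
    (hflat : deriv (deriv fun s : ℝ => wilsonAction4 (expChart (1 : GaugeField (F.P K) 0 (SU N)) (s • X))) 0 = 0) :
    X = 0 := by
  have hS : ∀ φ : Site (F.P K) 0 → lieSU (Fin N), (∀ y : Site (F.P K) k, φ (embIter k y) = 0) →
      (fun b : PBond (F.P K) 0 => φ b.tgt - φ b.src) ∈
        {Y : PBond (F.P K) 0 → lieSU (Fin N) |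
          ∀ x : Site (F.P K) 0, axialT (fun b : PBond (F.P K) 0 => Multiplicative.ofAdd (Y b)) (embIter k (iterBlockOf k x)) x = 1} →
      ∀ b : PBond (F.P K) 0, φ b.tgt - φ b.src = 0 := fun φ hφ hmem =>
    grad_eq_zero_of_combAxial φ hφ hmem
  exact eq_zero_of_fderiv_msChart_one_eq_zero_of_transversal 𝔹 h𝔹 hS hax hker hflat


/-- ★★ **POSITIVITY FORM IN THE COMB-AXIAL GAUGE**: a NONZERO comb-axial direction in the kernel of the flat chart's derivative has strictly positive flat second variation.
[cite: Balaban1989LargeFieldII, (1.9) p.358, p.359; Balaban1985Variational, Sect. E p.300] -/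
theorem deriv_deriv_pos_of_fderiv_msChart_one_eq_zero_of_combAxial (𝔹 : DetSet (F.P K)) (h𝔹 : ∀ c : PBond (F.P K) k, c ∈ bondsOf (𝔹 k))
    {X : PBond (F.P K) 0 → lieSU (Fin N)} (hX0 : X ≠ 0)
    (hax : ∀ x : Site (F.P K) 0, axialT (fun b : PBond (F.P K) 0 => Multiplicative.ofAdd (X b)) (embIter k (iterBlockOf k x)) x = 1)
    (hker : fderiv ℝ (msChart F N K k 𝔹 (avgFamily (avOfRecord F N K) (1 : GaugeField (F.P K) 0 (SU N))) (1 : GaugeField (F.P K) 0 (SU N))) 0 X = 0) :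
    0 < deriv (deriv fun s : ℝ => wilsonAction4 (expChart (1 : GaugeField (F.P K) 0 (SU N)) (s • X))) 0 :=
  lt_of_le_of_ne (N12FlatChartHnd.deriv_deriv_wilsonAction4_expChart_one_nonneg X) fun h =>
    hX0 (eq_zero_of_fderiv_msChart_one_eq_zero_of_combAxial 𝔹 h𝔹 hax hker h.symm)

/-- ★★ **THE `hnd` BINDER OF THE U2b THEOREM FOR EVERY GAUGE-FIXED FLAT CHART `X ↦ (Φ X, G X)` WHOSE GAUGE CONDITION IMPLIES THE COMB-AXIAL ONE** (e.g. `G` = the family of comb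
sums itself, or any finer linear gauge fixing): `DΨ(0)d = 0 ∧ D²(A∘expChart 1)(0)(d, ·)|_{ker DΨ(0)} = 0 ⟹ d = 0`, ready for
`B11Eq177CriticalFamilyDerivative.fderiv_flatCriticalExpChartFamily_eq` at `Ψ := (msChart … (M˙1) 1, G)`. [cite: Balaban1989LargeFieldII, (1.9) p.358, p.359; Balaban1985Variational, (83) p.290] -/
theorem hnd_flat_msChart_prod_of_combAxial (𝔹 : DetSet (F.P K)) (h𝔹 : ∀ c : PBond (F.P K) k, c ∈ bondsOf (𝔹 k))
    {W : Type*} [NormedAddCommGroup W] [NormedSpace ℝ W] (G : (PBond (F.P K) 0 → lieSU (Fin N)) →L[ℝ] W)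
    (hG : ∀ Y : PBond (F.P K) 0 → lieSU (Fin N), G Y = 0 →
      ∀ x : Site (F.P K) 0, axialT (fun b : PBond (F.P K) 0 => Multiplicative.ofAdd (Y b)) (embIter k (iterBlockOf k x)) x = 1)
    (d : PBond (F.P K) 0 → lieSU (Fin N))
    (hd : fderiv ℝ (fun X => (msChart F N K k 𝔹 (avgFamily (avOfRecord F N K) (1 : GaugeField (F.P K) 0 (SU N))) (1 : GaugeField (F.P K) 0 (SU N)) X, G X)) 0 d = 0)
    (hq : ∀ t, fderiv ℝ (fun X => (msChart F N K k 𝔹 (avgFamily (avOfRecord F N K) (1 : GaugeField (F.P K) 0 (SU N))) (1 : GaugeField (F.P K) 0 (SU N)) X, G X)) 0 t = 0 →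
      fderiv ℝ (fun Y => fderiv ℝ (fun Y : PBond (F.P K) 0 → lieSU (Fin N) =>
        wilsonAction4 (expChart (1 : GaugeField (F.P K) 0 (SU N)) Y)) Y) 0 d t = 0) :
    d = 0 :=
  hnd_flat_msChart_prod 𝔹 h𝔹 G (fun φ hφ hGφ => grad_eq_zero_of_combAxial φ hφ (hG _ hGφ)) d hd hq

end NodeZero

end Summit.QuantumFields.YangMills.BalabanUVNodes.N12FlatCombAxialHnd

end
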